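import Summits.QuantumAdvantage.AdviceFreeQNC0.BondTwistLocal
import Summits.QuantumAdvantage.AdviceFreeQNC0.HardcoreCylinder
import HarnessLib

/-!
# qa-qnc0-p1 g23 — ROUND-22 §2.7: the (G2) core in the 99% regime (STATEMENTS + one easy implication)

(VERBATIM copy of `HOME/qa-qnc0-p1/exp23/NP23.lean`, authored by the planner seat qn-p1 g23, farm rc 0 / 0 sorry; landed by the prover
seat qn-prover-3 g13 per ask P-23g as `AffBells23NearPerfect.lean`; only this paragraph and the docstring of `luc14` are new.  The §3
targets `AntipodalValueFormula` / `AntipodalLeThreeQuarters` are ask P-23h.)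

The crux `RingDenseResidualLt3` needs only SOME θ < 1.  Hence only NEAR-PERFECT strategies have to be excluded, and the
natural intermediate targets for the pure-linear core `BondTwist3.RingAffineBellsLt3` are

* `NoPerfectAffineBells3` — no affine MOD₃ bell strategy wins the ring relation on EVERY odd input (the EXACT version;
  weakest statement of the family, implied by `RingAffineBellsLt3`, proved below as `noPerfect_of_ringAffineBellsLt3`);
* `FibreConstancyRigidityAt3` (§2, (NP-i)) — the game-constant-free half: near-invariance of the ACTIVE XOR under pair-coin
  moves forces the same frame ⊗ junta structure;
* `NearPerfectRigidityAt3 μ₀ w₀ η` — a strategy winning on ≥ (1−η)·2^(N−1) odd inputs is, up to ≤ μ₀N exceptional rows,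
  FRAME ⊗ JUNTA: there is a set `S` of ≤ μ₀N rows such that every non-exceptional row differs from a combination of the
  `S`-rows in ≤ w₀ coordinates (a "U-relative w₀-junta", U = span of the S-rows).  Combined with the kernel-checked
  `AffBells23.frameAveraging` (exp23/FrameAveraging23.lean) this is the proposed road to `RingAffineBellsLt3`
  (ROUND-22 §2.7; parameter compatibility μ₀ ≤ μ_FA(δ, w₀, ε) is part of the claim to be established, not assumed here).

WHAT THIS IS NOT: statements only (plus one bookkeeping implication); no bound for any strategy; crux 22907 untouched.
-/

namespace Summit.QuantumAdvantage.AdviceFreeQNC0.AffBells23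

open Finset Literature.Computability.QuantumComplexity

/-- The affine MOD₃ bell strategy `z_k(x) = [⟨β_k, x⟩ = c_k]` (as in `BondTwist3.RingAffineBellsLt3`). -/
def affBell {N : ℕ} (β : Fin N → Fin N → ZMod 3) (c : Fin N → ZMod 3) (x : Fin N → Bool) (k : Fin N) : Bool :=
  decide ((∑ i : Fin N, if x i then β k i else 0) = c k)

/-- Number of odd inputs on which the affine bell strategy satisfies the ring relation. -/
noncomputable def affWinCard {N : ℕ} (β : Fin N → Fin N → ZMod 3) (c : Fin N → ZMod 3) : ℕ :=
  open scoped Classical in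
  (univ.filter fun x : Fin N → Bool => OddZeros x ∧ RingHLF.Rel x (affBell β c x)).card

/-- **(NP₀)** — the EXACT version of the (G2) core: for large rings, no affine MOD₃ bell strategy is perfect on the odd class. -/
def NoPerfectAffineBells3 : Prop :=
  ∃ n₀ : ℕ, ∀ N ≥ n₀, ∀ (β : Fin N → Fin N → ZMod 3) (c : Fin N → ZMod 3),
    ∃ x : Fin N → Bool, OddZeros x ∧ ¬ RingHLF.Rel x (affBell β c x)

/-- **(NP)** at parameters `(μ₀, w₀, η)` — NEAR-PERFECT RIGIDITY: an affine MOD₃ bell strategy winning on at least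
`(1 − η)·2^(N−1)` odd inputs is frame ⊗ junta up to `μ₀N` exceptional rows: some `S` with `#S ≤ μ₀N` and `E` with
`#E ≤ μ₀N` such that every row `b ∉ E` is within Hamming distance `w₀` of an 𝔽₃-combination of the rows in `S`. -/
def NearPerfectRigidityAt3 (μ₀ : ℝ) (w₀ : ℕ) (η : ℝ) : Prop :=
  ∃ n₀ : ℕ, ∀ N ≥ n₀, ∀ (β : Fin N → Fin N → ZMod 3) (c : Fin N → ZMod 3),
    (1 - η) * (2 : ℝ) ^ (N - 1) ≤ (affWinCard β c : ℝ) →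
      ∃ S E : Finset (Fin N), (S.card : ℝ) ≤ μ₀ * N ∧ (E.card : ℝ) ≤ μ₀ * N ∧
        ∀ b ∉ E, ∃ a : Fin N → ZMod 3, (∀ j ∉ S, a j = 0) ∧
          (univ.filter fun i : Fin N => β b i - ∑ j : Fin N, a j * β j i ≠ 0).card ≤ w₀

/-- **(NP)** — the qualitative rigidity conjecture: for every frame budget `μ₀ > 0` some junta width `w₀` and some
perfection threshold `η > 0` work. -/
def NearPerfectRigidity3 : Prop :=
  ∀ μ₀ : ℝ, 0 < μ₀ → ∃ w₀ : ℕ, ∃ η : ℝ, 0 < η ∧ NearPerfectRigidityAt3 μ₀ w₀ η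

/-- Bookkeeping: the rung `RingAffineBellsLt3` implies the exact version `(NP₀)` (`Fib19.card_isOdd`: the odd class has
`2^(N−1)` elements, so a perfect strategy would have win count `2^(N−1) > θ·2^(N−1)`). -/
theorem noPerfect_of_ringAffineBellsLt3 (h : BondTwist3.RingAffineBellsLt3) : NoPerfectAffineBells3 := by
  classical
  obtain ⟨θ, hθ, n₀, hn₀⟩ := h
  refine ⟨max n₀ 1, fun N hN β c => ?_⟩
  by_contra hall
  simp only [not_exists, not_and, not_not] at hall
  have hN₀ : n₀ ≤ N := le_trans (le_max_left _ _) hN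
  have hN₁ : 1 ≤ N := le_trans (le_max_right _ _) hN
  have hbound := hn₀ N hN₀ β c
  -- every odd input wins, so the win set is the whole odd class
  have hEq : (univ.filter fun x : Fin N → Bool =>
      OddZeros x ∧ RingHLF.Rel x (fun k => decide ((∑ i : Fin N, if x i then β k i else 0) = c k)))
      = (univ.filter fun x : Fin N → Bool => Fib19.IsOdd x) := by
    ext x
    simp only [mem_filter, mem_univ, true_and]
    constructor
    · intro hx; exact (Fib19.isOdd_iff_oddZeros x).2 hx.1
    · intro hx
      have ho : OddZeros x := (Fib19.isOdd_iff_oddZeros x).1 hx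
      exact ⟨ho, hall x ho⟩
  rw [hEq, Fib19.card_isOdd hN₁] at hbound
  have hpos : (0 : ℝ) < (2 : ℝ) ^ (N - 1) := by positivity
  have : (2 : ℝ) ^ (N - 1) ≤ θ * (2 : ℝ) ^ (N - 1) := by exact_mod_cast hbound
  nlinarith

/-! ### §2 The fibre-constancy half (NP-i) — game-constant-free rigidity (ROUND-22 §2.7 refinement)

On a fibre of the kernel line the coin parity is fixed (`Fib19.card_fibre`), so `WIN(x) ⟺ ⊕_{b ∈ supp J(x)} z_b(x) = κ_J`; perfection
splits into (i) invariance of the ACTIVE XOR under the pair-coin move `flipAt x {c, c'}` (`Fib19.kline_flipPair`: same fibre) and (ii) the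
right constant per fibre.  (ii) is what the global theorems (R0 / JuntaHard / frame averaging) decide; (i) is where spread rows must fail. -/

/-- The XOR of the affine bells over the ACTIVE positions `supp (kline x)`. -/
def activeXor {N : ℕ} (β : Fin N → Fin N → ZMod 3) (c : Fin N → ZMod 3) (x : Fin N → Bool) : Bool :=
  (univ.filter fun b : Fin N => Fib19.kline x b = true ∧ affBell β c x b = true).card % 2 == 1

/-- Number of (odd input, ordered coin pair) triples on which the pair-coin move CHANGES the active XOR. -/
noncomputable def pairMoveDefects {N : ℕ} (β : Fin N → Fin N → ZMod 3) (c : Fin N → ZMod 3) : ℕ :=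
  open scoped Classical in
  (univ.filter fun t : (Fin N → Bool) × Fin N × Fin N =>
      OddZeros t.1 ∧ Fib19.kline t.1 t.2.1 = false ∧ Fib19.kline t.1 t.2.2 = false ∧ t.2.1 ≠ t.2.2 ∧
        activeXor β c (Fib19.flipAt t.1 {t.2.1, t.2.2}) ≠ activeXor β c t.1).card

/-- **(NP-i)** at parameters `(μ₀, w₀, η)`: if the pair-coin move changes the active XOR on at most an `η`-fraction of
(odd input, coin pair) triples (normalised by `N²·2^(N−1)`), then the row system is frame ⊗ junta up to `μ₀N` exceptional rows
(same conclusion as `NearPerfectRigidityAt3`).  No game constant, no `tGuess`: a statement about `β`, `c` and the hard-core fibration. -/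
def FibreConstancyRigidityAt3 (μ₀ : ℝ) (w₀ : ℕ) (η : ℝ) : Prop :=
  ∃ n₀ : ℕ, ∀ N ≥ n₀, ∀ (β : Fin N → Fin N → ZMod 3) (c : Fin N → ZMod 3),
    (pairMoveDefects β c : ℝ) ≤ η * ((N : ℝ) ^ 2 * (2 : ℝ) ^ (N - 1)) →
      ∃ S E : Finset (Fin N), (S.card : ℝ) ≤ μ₀ * N ∧ (E.card : ℝ) ≤ μ₀ * N ∧
        ∀ b ∉ E, ∃ a : Fin N → ZMod 3, (∀ j ∉ S, a j = 0) ∧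
          (univ.filter fun i : Fin N => β b i - ∑ j : Fin N, a j * β j i ≠ 0).card ≤ w₀

/-- **(NP-i)**, qualitative form. -/
def FibreConstancyRigidity3 : Prop :=
  ∀ μ₀ : ℝ, 0 < μ₀ → ∃ w₀ : ℕ, ∃ η : ℝ, 0 < η ∧ FibreConstancyRigidityAt3 μ₀ w₀ η

/-! ### §3 The antipodal 2-junta — the one translation-invariant light family above 2/3, solved exactly (ROUND-22 §2.8)

`z_b(x) = x_{b+1} ⊕ x_{b+N/2}` is the affine MOD₃ bell `[x_{b+1} + x_{b+N/2} ≡ 1]` (row `β_b = e_{b+1} + e_{b+N/2}`, offset `1`).  Brute force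
(kit j305037/j305096, N ≤ 24) and a 16-state transfer matrix on the folded cycle (exp23/antipodal_tm.py, exact) give the closed form below;
its maximum is `P(10) = 0.746`, and `P(N) → 1/2` like `½·((3+√17)/8)^{N/2}`.  Typed here as targets for ask P-23h (R0's transfer-matrix template). -/

/-- Row system of the antipodal strategy on `Fin N` (meaningful for even `N ≥ 4`): `β_b = e_{b+1} + e_{b+N/2}`. -/
def antipodalRows (N : ℕ) (b i : Fin N) : ZMod 3 :=
  (if i.val = (b.val + 1) % N then 1 else 0) + (if i.val = (b.val + N / 2) % N then 1 else 0)

/-- The Lucas-type sequences of the closed form: `a_h = 3a_{h−1} + 2a_{h−2}`, `a₀ = 2`, `a₁ = 3` (traces of `x² − 3x − 2`) and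
`b_h = b_{h−1} + 4b_{h−2}`, `b₀ = 2`, `b₁ = 1` (traces of `x² − x − 4`). -/
def luc32 : ℕ → ℤ
  | 0 => 2
  | 1 => 3
  | (h + 2) => 3 * luc32 (h + 1) + 2 * luc32 h

/-- `b_h = b_{h−1} + 4b_{h−2}`, `b₀ = 2`, `b₁ = 1` (traces of `x² − x − 4`). -/
def luc14 : ℕ → ℤ
  | 0 => 2
  | 1 => 1
  | (h + 2) => luc14 (h + 1) + 4 * luc14 h

/-- **Antipodal value formula** (verified numerically for every even `N = 6..40`; to be PROVED, ask P-23h):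
`4 · wins(N) = 2^N + a_{N/2} − (−2)^{N/2} − b_{N/2}`. -/
def AntipodalValueFormula : Prop :=
  ∀ N : ℕ, 6 ≤ N → N % 2 = 0 →
    (4 * (affWinCard (antipodalRows N) (fun _ => (1 : ZMod 3)) : ℤ)) = 2 ^ N + luc32 (N / 2) - (-2) ^ (N / 2) - luc14 (N / 2)

/-- **Corollary target**: the antipodal strategy never wins more than `3/4` of the odd inputs (max `0.746` at `N = 10`), for every even `N ≥ 6`. -/
def AntipodalLeThreeQuarters : Prop :=
  ∀ N : ℕ, 6 ≤ N → N % 2 = 0 → (4 * affWinCard (antipodalRows N) (fun _ => (1 : ZMod 3))) ≤ 3 * 2 ^ (N - 1)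

/-- sanity: the recurrences reproduce the verified instance `N = 12`: `2¹² + a₆ − 64 − b₆ = 4096 + 2041 − 64 − 297 = 5776 = 4 · 1444`. -/
example : (2 : ℤ) ^ 12 + luc32 6 - (-2) ^ 6 - luc14 6 = 4 * 1444 := by decide

end Summit.QuantumAdvantage.AdviceFreeQNC0.AffBells23
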